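import Summits.AtomisticToContinuum.Crystallization.Theorems.OverbindingBudgetAffineRadialJetB

/-!
# Radial JET tables for the far-core certificate (slot Z, leaf Z2): polynomial jets, the jet model ψ_J, Gram-chart glue with a radius split, (lower) proved, (upper) reduced to the chart, three zones — part 3 of 3 (sequel of `…OverbindingBudgetAffineRadialJetB`)

Split for the 400-line cap by the landing lane (hand-2 g33); the module docstring of part 1 (`…OverbindingBudgetAffineRadialJetA`) describes the whole node.  Same namespace; all FQNs unchanged.
0 sorry; standard axioms.
-/

noncomputable section
open Set

namespace Summit.AtomisticToContinuum.Crystallization.Theorems.OverbindingBudgetAffineRadialJet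

open Literature.MathematicalPhysics.StatisticalMechanics
open Summit.AtomisticToContinuum.Crystallization.Theorems.OverbindingBudgetAffineFarSmoothSplit
open Summit.AtomisticToContinuum.Crystallization.Theorems.OverbindingBudgetAffineRadialReduction
open Summit.AtomisticToContinuum.Crystallization.Theorems.OverbindingBudgetAffineRadialGlue
open Summit.AtomisticToContinuum.Crystallization.Theorems.OverbindingBudgetAffineRadialChart

local notation "E3" => EuclideanSpace ℝ (Fin 3)
local notation "E5" => EuclideanSpace ℝ (Fin 5)

/-! ## §7 The (upper) obligation REDUCED TO THE CHART: `s⁶·T₃↑(w, X)` is an explicit function of `gramChart X`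

Multiplying by `chartScale X⁶` turns every layer term into `(chartForm (gramChart X) (redIdx i j o k))⁻³`
(`…RadialChart.normSq_redVec_eq_chart`), hence the whole window sum `T₃↑` into a function of the chart point ALONE:
the near family (finite index sets `S k ⊆ ℤ²` of the window layers `|k| ≤ 3`), the in-plane RESTS of the seven window
layers, and the coset-max FAR LAYERS `|k| ≥ 4`.  So (upper-J) is EXACTLY the chart-level JET MAJORISATION
`Σ_{|k|≤3} chartLayerRest 3 y k ℓ_k (S k) + chartFarSix y ≤ J₃(y)` on the jet ANNULUS `r₁ ≤ ‖y − x₀‖ ≤ ρ₁` of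
`KRegion (196/121)` — five real variables, no `X`, no window data beyond the labels (★★ `hupper_of_chartMajorant`,
literally the `hupper` obligation of ★★★ `farCoreExcess_of_threeZoneJetTables`; ◇ `upper_of_chartMajorant` is the
no-split variant on the whole region); its certification is memo §3 (J1–J4). -/

section UpperReduction

variable {θ' : ℝ} {w : Fin 6 → ℤ}

/-- Chart-level inverse-power term of a reduced index: `(chartForm y n)^{−p}`. -/
def chartTerm (p : ℕ) (y : E5) (n : Fin 3 → ℝ) : ℝ := ((chartForm y n) ^ p)⁻¹

/-- Chart-level LAYER SUM: `Σ'_{(i,j) ∈ ℤ²} (chartForm y (redIdx i j o k))^{−p}`. -/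
def chartLayerSum (p : ℕ) (y : E5) (k o : ℤ) : ℝ := ∑' ij : ℤ × ℤ, chartTerm p y (redIdx ij.1 ij.2 o k)

/-- The in-plane REST of a chart layer sum outside a finite index set `S`. -/
def chartLayerRest (p : ℕ) (y : E5) (k o : ℤ) (S : Finset (ℤ × ℤ)) : ℝ :=
  ∑' ij : ℤ × ℤ, if ij ∈ S then 0 else chartTerm p y (redIdx ij.1 ij.2 o k)

/-- The chart-level FAR LAYERS of the cube window sum: `Σ'_{|k| ≥ 4} max_{o ∈ {0,1,2}} chartLayerSum 3 y k o`. -/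
def chartFarSix (y : E5) : ℝ :=
  ∑' k : ℤ, if |k| ≤ 3 then 0 else max (chartLayerSum 3 y k 0) (max (chartLayerSum 3 y k 1) (chartLayerSum 3 y k 2))

/-- ★★ **J2 BRIDGE — the in-plane REST of a chart layer majorised by its three jet sums.**  If outside the near set `S`
the chart form splits as `chartForm y (redIdx i j o k) = c₀ ij + L ij` (centre value + displacement part), with `c₀ > 0`,
`c₀ + L > 0`, anisotropy `c₀ ≤ μ(c₀ + L)`, pencil bound `|L| ≤ λ·r·c₀`, and the coefficient families over the complement of `S`
have sums `F, G, H`, then `chartLayerRest 3 y k o S ≤ F − 3G + (6 + 10μ³λr)·H` — `tsum_inv_cube_le_jet` on the subtype `↥(↑S)ᶜ`.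
(Memo §3 J2: with `c₀ ij = chartForm x₀ (…)`, `L ij` the linear part at `δ = y − x₀`, `G`/`H` are linear/quadratic in `δ`.) [this file] -/
theorem chartLayerRest_le_jet {y : E5} {k o : ℤ} {S : Finset (ℤ × ℤ)} {c₀ L : ℤ × ℤ → ℝ} {μ lam r F G H : ℝ}
    (hcL : ∀ ij, ij ∉ S → chartForm y (redIdx ij.1 ij.2 o k) = c₀ ij + L ij)
    (hc₀ : ∀ ij, ij ∉ S → 0 < c₀ ij) (hc : ∀ ij, ij ∉ S → 0 < c₀ ij + L ij)
    (hμ : ∀ ij, ij ∉ S → c₀ ij ≤ μ * (c₀ ij + L ij)) (hlam : ∀ ij, ij ∉ S → |L ij| ≤ lam * r * c₀ ij)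
    (hlr : 0 ≤ lam * r)
    (hF : HasSum (fun ij : ↥((S : Set (ℤ × ℤ))ᶜ) => (c₀ ij ^ 3)⁻¹) F)
    (hG : HasSum (fun ij : ↥((S : Set (ℤ × ℤ))ᶜ) => L ij * (c₀ ij ^ 4)⁻¹) G)
    (hH : HasSum (fun ij : ↥((S : Set (ℤ × ℤ))ᶜ) => L ij ^ 2 * (c₀ ij ^ 5)⁻¹) H) :
    chartLayerRest 3 y k o S ≤ F - 3 * G + (6 + 10 * μ ^ 3 * (lam * r)) * H := by
  have hmem : ∀ ij : ↥((S : Set (ℤ × ℤ))ᶜ), (ij : ℤ × ℤ) ∉ S :=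
    fun ij h => ((Set.mem_compl_iff _ _).1 ij.2) (Finset.mem_coe.2 h)
  have key := tsum_inv_cube_le_jet (α := ↥((S : Set (ℤ × ℤ))ᶜ))
    (c₀ := fun ij => c₀ ij) (L := fun ij => L ij)
    (fun ij => hc₀ ij (hmem ij)) (fun ij => hc ij (hmem ij)) (fun ij => hμ ij (hmem ij))
    (fun ij => hlam ij (hmem ij)) hlr hF hG hH
  have hrest : chartLayerRest 3 y k o S = ∑' ij : ↥((S : Set (ℤ × ℤ))ᶜ), ((c₀ ij + L ij) ^ 3)⁻¹ := by
    unfold chartLayerRest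
    have h1 : (fun ij : ℤ × ℤ => if ij ∈ S then (0 : ℝ) else chartTerm 3 y (redIdx ij.1 ij.2 o k))
        = ((S : Set (ℤ × ℤ))ᶜ).indicator (fun ij => chartTerm 3 y (redIdx ij.1 ij.2 o k)) := by
      funext ij
      by_cases h : ij ∈ S
      · simp [h]
      · simp [h]
    rw [h1, ← tsum_subtype]
    apply tsum_congr
    intro ij
    show chartTerm 3 y (redIdx (ij : ℤ × ℤ).1 (ij : ℤ × ℤ).2 o k) = ((c₀ ij + L ij) ^ 3)⁻¹
    unfold chartTerm
    rw [hcL ij (hmem ij)]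
  rw [hrest]
  exact key.2

/-- `chartScale X⁶ · layerTerm X 6 k o (i,j) = (chartForm (gramChart X) (redIdx i j o k))⁻³`. [this file] -/
theorem scale_pow_six_mul_layerTerm {X : E3 →ₗ[ℝ] E3} (hs : chartScale X ≠ 0) (k o : ℤ) (ij : ℤ × ℤ) :
    chartScale X ^ 6 * layerTerm X 6 k o ij = chartTerm 3 (gramChart X) (redIdx ij.1 ij.2 o k) := by
  have e1 : layerTerm X 6 k o ij = (‖X (layerVec ij.1 ij.2 o k)‖)⁻¹ ^ 6 := rfl
  have e2 : ‖X (layerVec ij.1 ij.2 o k)‖ ^ 2 = chartScale X ^ 2 * chartForm (gramChart X) (redIdx ij.1 ij.2 o k) := by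
    rw [layerVec_eq_redVec, normSq_redVec_eq_chart hs]
  have e3 : (‖X (layerVec ij.1 ij.2 o k)‖)⁻¹ ^ 6 = ((‖X (layerVec ij.1 ij.2 o k)‖ ^ 2) ^ 3)⁻¹ := by
    rw [inv_pow, ← pow_mul]
  unfold chartTerm
  rw [e1, e3, e2, mul_pow, ← pow_mul, mul_inv, ← mul_assoc, mul_inv_cancel₀ (pow_ne_zero _ hs), one_mul]

/-- `chartScale X⁶ · layerSum X 6 k o = chartLayerSum 3 (gramChart X) k o`. [this file] -/
theorem scale_pow_six_mul_layerSum {X : E3 →ₗ[ℝ] E3} (hs : chartScale X ≠ 0) (k o : ℤ) :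
    chartScale X ^ 6 * layerSum X 6 k o = chartLayerSum 3 (gramChart X) k o := by
  unfold layerSum chartLayerSum
  rw [← tsum_mul_left]
  exact tsum_congr fun ij => scale_pow_six_mul_layerTerm hs k o ij

/-- A summable chart layer sum splits into a finite part and its rest. [formal bookkeeping] -/
theorem chartLayerSum_eq_sum_add_rest {p : ℕ} {y : E5} {k o : ℤ} (S : Finset (ℤ × ℤ))
    (h : Summable fun ij : ℤ × ℤ => chartTerm p y (redIdx ij.1 ij.2 o k)) :
    chartLayerSum p y k o = ∑ ij ∈ S, chartTerm p y (redIdx ij.1 ij.2 o k) + chartLayerRest p y k o S := by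
  set g : ℤ × ℤ → ℝ := fun ij => chartTerm p y (redIdx ij.1 ij.2 o k) with hg
  set a : ℤ × ℤ → ℝ := fun ij => if ij ∈ S then g ij else 0 with ha
  set b : ℤ × ℤ → ℝ := fun ij => if ij ∈ S then 0 else g ij with hb
  have hab : ∀ ij, g ij = a ij + b ij := fun ij => by
    by_cases hij : ij ∈ S
    · simp only [ha, hb, if_pos hij, add_zero]
    · simp only [ha, hb, if_neg hij, zero_add]
  have ha_supp : ∀ ij ∉ S, a ij = 0 := fun ij hij => if_neg hij
  have has : Summable a := summable_of_ne_finset_zero ha_supp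
  have hbs : Summable b := (h.sub has).congr fun ij => by
    show g ij - a ij = b ij
    rw [hab ij]; ring
  calc chartLayerSum p y k o = ∑' ij, g ij := rfl
    _ = ∑' ij, (a ij + b ij) := tsum_congr hab
    _ = ∑' ij, a ij + ∑' ij, b ij := Summable.tsum_add has hbs
    _ = ∑ ij ∈ S, chartTerm p y (redIdx ij.1 ij.2 o k) + chartLayerRest p y k o S := by
        rw [tsum_eq_sum ha_supp]
        congr 1
        exact Finset.sum_congr rfl fun ij hij => if_pos hij

/-- ★ **`s⁶·T₃↑` on the chart.**  For the data of a far window and any finite near index sets `S k ⊆ ℤ²` of the window layers: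
`chartScale X⁶ · windowSixUp w X = Σ_{|k|≤3} Σ_{(i,j)∈S k} chartTerm 3 (gramChart X) (wIdx w (k,i,j))
  + ( Σ_{|k|≤3} chartLayerRest 3 (gramChart X) k ℓ_k (S k) + chartFarSix (gramChart X) )`. [this file] -/
theorem scale_pow_six_mul_windowSixUp {X : E3 →ₗ[ℝ] E3} (hX : FarWindowData (1 / 25) θ' w X) (S : ℤ → Finset (ℤ × ℤ)) :
    chartScale X ^ 6 * windowSixUp w X =
      ∑ k ∈ Finset.Icc (-3 : ℤ) 3, ∑ ij ∈ S k, chartTerm 3 (gramChart X) (wIdx w (k, ij)) +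
        (∑ k ∈ Finset.Icc (-3 : ℤ) 3, chartLayerRest 3 (gramChart X) k (windowLabel w k) (S k) +
          chartFarSix (gramChart X)) := by
  have hs0 : 0 < chartScale X := scale_pos_of_farWindowData (by norm_num) hX
  have hs : chartScale X ≠ 0 := hs0.ne'
  have hhs : IsHaggSeq (seqOfWindow w) := isHaggSeq_seqOfWindow hX.1
  have hm : (3 : ℝ) * (1 / 25) ≤ 1 / 6 := by norm_num
  have hU : Summable fun k : ℤ => layerUp w X 6 k := by
    have h := (summable_layerUp_layerLo hhs hm hX.2.1).1
    rwa [windowOf_seqOfWindow] at h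
  obtain ⟨-, -, h6, -⟩ := summable_layerSum_chart hhs hm hX.2.1
  set near : ℤ → ℝ := fun k => if |k| ≤ 3 then layerUp w X 6 k else 0 with hnear
  set far : ℤ → ℝ := fun k => if |k| ≤ 3 then 0 else layerUp w X 6 k with hfar
  have hnf : ∀ k, layerUp w X 6 k = near k + far k := fun k => by
    by_cases h : |k| ≤ 3
    · simp only [hnear, hfar, if_pos h, add_zero]
    · simp only [hnear, hfar, if_neg h, zero_add]
  have hnear_supp : ∀ k ∉ Finset.Icc (-3 : ℤ) 3, near k = 0 := fun k hk => by
    rw [Finset.mem_Icc] at hk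
    exact if_neg fun h => hk (abs_le.1 h)
  have hnear_s : Summable near := summable_of_ne_finset_zero hnear_supp
  have hfar_s : Summable far := (hU.sub hnear_s).congr fun k => by
    show layerUp w X 6 k - near k = far k
    rw [hnf k]; ring
  have hnear_sum : ∑ k ∈ Finset.Icc (-3 : ℤ) 3, near k = ∑ k ∈ Finset.Icc (-3 : ℤ) 3, layerSum X 6 k (windowLabel w k) := by
    refine Finset.sum_congr rfl fun k hk => ?_
    rw [Finset.mem_Icc] at hk
    have hk' : |k| ≤ 3 := abs_le.2 ⟨hk.1, hk.2⟩
    simp only [hnear, if_pos hk']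
    unfold layerUp
    rw [if_pos hk']
  have hsplit : windowSixUp w X = ∑ k ∈ Finset.Icc (-3 : ℤ) 3, layerSum X 6 k (windowLabel w k) + ∑' k, far k := by
    unfold windowSixUp
    rw [tsum_congr hnf, Summable.tsum_add hnear_s hfar_s, tsum_eq_sum hnear_supp, hnear_sum]
  have hwin : ∀ k ∈ Finset.Icc (-3 : ℤ) 3, chartScale X ^ 6 * layerSum X 6 k (windowLabel w k) =
      ∑ ij ∈ S k, chartTerm 3 (gramChart X) (wIdx w (k, ij)) +
        chartLayerRest 3 (gramChart X) k (windowLabel w k) (S k) := by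
    intro k hk
    rw [Finset.mem_Icc] at hk
    have hk' : |k| ≤ 3 := abs_le.2 ⟨hk.1, hk.2⟩
    rw [scale_pow_six_mul_layerSum hs]
    have hsum : Summable fun ij : ℤ × ℤ => chartTerm 3 (gramChart X) (redIdx ij.1 ij.2 (windowLabel w k) k) := by
      have h := (h6 k).mul_left (chartScale X ^ 6)
      rw [haggLabel_seqOfWindow w hk'] at h
      exact h.congr fun ij => scale_pow_six_mul_layerTerm hs k _ ij
    exact chartLayerSum_eq_sum_add_rest (S k) hsum
  have hfarid : chartScale X ^ 6 * ∑' k, far k = chartFarSix (gramChart X) := by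
    unfold chartFarSix
    rw [← tsum_mul_left]
    refine tsum_congr fun k => ?_
    by_cases hk : |k| ≤ 3
    · simp only [hfar, if_pos hk, mul_zero]
    · simp only [hfar, if_neg hk]
      unfold layerUp
      rw [if_neg hk, mul_max_of_nonneg _ _ (pow_nonneg hs0.le 6), mul_max_of_nonneg _ _ (pow_nonneg hs0.le 6),
        scale_pow_six_mul_layerSum hs, scale_pow_six_mul_layerSum hs, scale_pow_six_mul_layerSum hs]
  rw [hsplit, mul_add, Finset.mul_sum, hfarid, Finset.sum_congr rfl hwin, Finset.sum_add_distrib, add_assoc]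

/-- ★★ **(upper-J) ⟸ the chart-level JET MAJORISATION ON THE ANNULUS.**  If the family's cube sum IS the near double
sum (`D.S 2 y = Σ_{|k|≤3} Σ_{(i,j)∈S k} chartTerm 3 y (wIdx w (k,i,j))`) and the jet majorises the rest on the jet annulus
of the chart region (`Σ_{|k|≤3} chartLayerRest 3 y k ℓ_k (S k) + chartFarSix y ≤ J₃(y)` for `y ∈ KRegion (196/121)`,
`r₁ ≤ ‖y − x₀‖ ≤ ρ₁` — the radius range on which the jet side conditions are certified), then the per-window obligation
`hupper` of ★★★ `farCoreExcess_of_threeZoneJetTables` holds (generation 70: outer radius added, critic row 1246 (U1)).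
[this file] -/
theorem hupper_of_chartMajorant {ι : Type*} (D : FamilyData E5 ι) (J₃ : JetData E5) (S : ℤ → Finset (ℤ × ℤ))
    (hDS : ∀ y : E5, D.S 2 y = ∑ k ∈ Finset.Icc (-3 : ℤ) 3, ∑ ij ∈ S k, chartTerm 3 y (wIdx w (k, ij)))
    {x₀ : E5} {r₁ ρ₁ : ℝ}
    (hmaj : ∀ y ∈ KRegion (196 / 121), r₁ ≤ ‖y - x₀‖ → ‖y - x₀‖ ≤ ρ₁ →
      ∑ k ∈ Finset.Icc (-3 : ℤ) 3, chartLayerRest 3 y k (windowLabel w k) (S k) + chartFarSix y ≤ J₃.eval y) :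
    ∀ X : E3 →ₗ[ℝ] E3, FarWindowData (1 / 25) θ' w X → r₁ ≤ ‖gramChart X - x₀‖ → ‖gramChart X - x₀‖ ≤ ρ₁ →
      chartScale X ^ 6 * windowSixUp w X ≤ PJ D J₃ (gramChart X) := by
  intro X hX hr hρ
  rw [scale_pow_six_mul_windowSixUp hX S]
  unfold PJ
  rw [hDS]
  have h := hmaj _ (mem_K_record hX) hr hρ
  linarith

/-- ◇ The same without radius split (a jet majorant on all of `KRegion (196/121)` gives (upper-J) at every admissible `X`).
[this file] -/
theorem upper_of_chartMajorant {ι : Type*} (D : FamilyData E5 ι) (J₃ : JetData E5) (S : ℤ → Finset (ℤ × ℤ))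
    (hDS : ∀ y : E5, D.S 2 y = ∑ k ∈ Finset.Icc (-3 : ℤ) 3, ∑ ij ∈ S k, chartTerm 3 y (wIdx w (k, ij)))
    (hmaj : ∀ y ∈ KRegion (196 / 121),
      ∑ k ∈ Finset.Icc (-3 : ℤ) 3, chartLayerRest 3 y k (windowLabel w k) (S k) + chartFarSix y ≤ J₃.eval y)
    {X : E3 →ₗ[ℝ] E3} (hX : FarWindowData (1 / 25) θ' w X) :
    chartScale X ^ 6 * windowSixUp w X ≤ PJ D J₃ (gramChart X) := by
  rw [scale_pow_six_mul_windowSixUp hX S]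
  unfold PJ
  rw [hDS]
  have h := hmaj _ (mem_K_record hX)
  linarith

end UpperReduction

/-! ## §8 Three zones: inner ball (zone I/II device) · JET ANNULUS `r₁ ≤ ‖y − x₀‖ ≤ ρ₁` · outer shell (any table)

A single global jet is tight on the core and loose far out (the cubic remainder carried by the quartic grows like `‖δ‖⁴`);
conversely per-cell CONSTANT far fields are cheap far out (`h ≤ 15.8·α·r²` is no constraint for `r ≥ 0.2`) and fatal on the
core.  The natural certificate therefore has THREE zones, glued here: the radial reduction runs on the star-convex JET REGION
`KRegion (196/121) ∩ closedBall x₀ ρ₁` only (so (upper-J)/(lower-J) and the radial tables are needed there only), the inner ball is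
the zone-I/II device and the outer shell `‖gramChart X − x₀‖ > ρ₁` is ANY ratio table (the line of record's value cells). -/

section ThreeZones

variable {ι : Type*} {θ' : ℝ} {w : Fin 6 → ℤ}

/-- ★ THE THREE-ZONE SPLIT of a window's ratio table. [this file] -/
theorem table_of_split₃ {b r₁ ρ₁ : ℝ} {x₀ : E5}
    (hinner : ∀ X : E3 →ₗ[ℝ] E3, FarWindowData (1 / 25) θ' w X → ‖gramChart X - x₀‖ < r₁ →
      b * windowSixUp w X ^ 2 ≤ windowTwelveLo w X)
    (hannulus : ∀ X : E3 →ₗ[ℝ] E3, FarWindowData (1 / 25) θ' w X → r₁ ≤ ‖gramChart X - x₀‖ →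
      ‖gramChart X - x₀‖ ≤ ρ₁ → b * windowSixUp w X ^ 2 ≤ windowTwelveLo w X)
    (houter : ∀ X : E3 →ₗ[ℝ] E3, FarWindowData (1 / 25) θ' w X → ρ₁ < ‖gramChart X - x₀‖ →
      b * windowSixUp w X ^ 2 ≤ windowTwelveLo w X) :
    ∀ X : E3 →ₗ[ℝ] E3, FarWindowData (1 / 25) θ' w X → b * windowSixUp w X ^ 2 ≤ windowTwelveLo w X := by
  intro X hX
  rcases lt_or_ge ‖gramChart X - x₀‖ r₁ with h | h
  · exact hinner X hX h
  · rcases le_or_gt ‖gramChart X - x₀‖ ρ₁ with h' | h'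
    · exact hannulus X hX h h'
    · exact houter X hX h'

/-- The jet region `KRegion Λ ∩ closedBall x₀ ρ₁` is star-convex with respect to a centre in `KRegion Λ`. [formal bookkeeping] -/
theorem starConvex_KRegion_inter_closedBall {Λ : ℝ} {x₀ : E5} {ρ₁ : ℝ} (hx₀ : x₀ ∈ KRegion Λ) (hρ₁ : 0 ≤ ρ₁) :
    StarConvex ℝ x₀ (KRegion Λ ∩ Metric.closedBall x₀ ρ₁) :=
  (starConvex_KRegion _ hx₀).inter ((convex_closedBall x₀ ρ₁).starConvex (Metric.mem_closedBall_self hρ₁))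

variable {D : FamilyData E5 ι} {J₃ J₆ : JetData E5} {x₀ : E5} {ρ ρ₁ m₀ η δ₀ b r₁ : ℝ}

/-- ★★ **The ANNULUS table from the jet radial tables on the jet region** `K₁ = KRegion (196/121) ∩ closedBall x₀ ρ₁`:
(upper-J)/(lower-J) at admissible `X` with `r₁ ≤ ‖gramChart X − x₀‖ ≤ ρ₁`, non-vanishing and `PJ > 0` on `K₁`, (C) on
`K₁ ∩ B(x₀, ρ)`, (B) on `K₁ ∖ B(x₀, ρ)`, (G),(0), side conditions ⇒ the ratio inequality on the annulus. [this file] -/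
theorem annulusTable_of_radialTablesJ
    (hupper : ∀ X : E3 →ₗ[ℝ] E3, FarWindowData (1 / 25) θ' w X → r₁ ≤ ‖gramChart X - x₀‖ → ‖gramChart X - x₀‖ ≤ ρ₁ →
      chartScale X ^ 6 * windowSixUp w X ≤ PJ D J₃ (gramChart X))
    (hlower : ∀ X : E3 →ₗ[ℝ] E3, FarWindowData (1 / 25) θ' w X → r₁ ≤ ‖gramChart X - x₀‖ → ‖gramChart X - x₀‖ ≤ ρ₁ →
      NJ D J₆ (gramChart X) ≤ chartScale X ^ 12 * windowTwelveLo w X)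
    (hx₀ : x₀ ∈ KRegion (196 / 121)) (hρ₁ : 0 ≤ ρ₁)
    (hpos : ∀ y ∈ KRegion (196 / 121) ∩ Metric.closedBall x₀ ρ₁, ∀ i ∈ D.s, D.c i + D.L i y ≠ 0)
    (hP : ∀ y ∈ KRegion (196 / 121) ∩ Metric.closedBall x₀ ρ₁, 0 < PJ D J₃ y)
    (hC : ∀ y ∈ KRegion (196 / 121) ∩ Metric.closedBall x₀ ρ₁, ‖y - x₀‖ ≤ ρ → ∀ u : E5, ‖u‖ = 1 →
      m₀ ≤ psiJ₂ D J₃ J₆ y u)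
    (hB : ∀ y ∈ KRegion (196 / 121) ∩ Metric.closedBall x₀ ρ₁, ρ ≤ ‖y - x₀‖ →
      0 < psiJ₁ D J₃ J₆ y (‖y - x₀‖⁻¹ • (y - x₀)) ∨ 0 < psiJ₂ D J₃ J₆ y (‖y - x₀‖⁻¹ • (y - x₀)))
    (hG : ∀ u : E5, ‖u‖ = 1 → -η ≤ psiJ₁ D J₃ J₆ x₀ u) (h0 : b - δ₀ ≤ psiJ D J₃ J₆ x₀)
    (hr₁ : 0 < r₁) (hrρ : r₁ ≤ ρ)
    (hq : ∀ t ∈ Icc r₁ ρ, δ₀ + η * t ≤ m₀ / 2 * t ^ 2) (hρη : η < m₀ * ρ) (hb : 0 ≤ b) :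
    ∀ X : E3 →ₗ[ℝ] E3, FarWindowData (1 / 25) θ' w X → r₁ ≤ ‖gramChart X - x₀‖ → ‖gramChart X - x₀‖ ≤ ρ₁ →
      b * windowSixUp w X ^ 2 ≤ windowTwelveLo w X := by
  intro X hX hr hr'
  have hxK : gramChart X ∈ KRegion (196 / 121) ∩ Metric.closedBall x₀ ρ₁ :=
    ⟨mem_K_record hX, by rw [Metric.mem_closedBall, dist_eq_norm]; exact hr'⟩
  have hψ := radial_reductionJ D J₃ J₆ (starConvex_KRegion_inter_closedBall hx₀ hρ₁) hpos (fun y hy => (hP y hy).ne')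
    hC hB hG h0 hr₁ hrρ hq hρη (gramChart X) hxK hr
  exact ratio_of_chartTables hX (hupper X hX hr hr') (hlower X hX hr hr') (hP _ hxK) hb hψ

end ThreeZones

section EndToEndThree

variable {ι : Type*} {c τ l3 L6hi b : ℝ}
  {D : (Fin 6 → ℤ) → FamilyData E5 ι} {J₃ J₆ : (Fin 6 → ℤ) → JetData E5} {x₀ : (Fin 6 → ℤ) → E5}
  {ρ ρ₁ m₀ η δ₀ r₁ : (Fin 6 → ℤ) → ℝ}

/-- ★★★ **Z2 from THREE-ZONE tables.**  Per window: an inner table on `B(x₀ w, r₁ w)` (zone I/II), an OUTER table beyond `ρ₁ w`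
(any certificate — e.g. the line of record's value cells with constant far fields, cheap there), and on the jet annulus the jet
enclosures (upper-J)/(lower-J) + the radial tables of `ψ_J` on `KRegion (196/121) ∩ closedBall (x₀ w) (ρ₁ w)`; plus the side
conditions and the hcp enclosures. [this file] -/
theorem farCoreExcess_of_threeZoneJetTables (hc : c ≠ 0) (hτ : 0 < τ) (hτ' : τ ≤ 1 / 100)
    (hl3 : 0 < l3) (hL3 : l3 ≤ StackingSums.hcpInvPowSum 3 c) (hL6 : StackingSums.hcpInvPowSum 6 c ≤ L6hi)
    (hκ : 24 * (1 / (2 * 10 ^ 7) + 1 / 10 ^ 9) * L6hi ≤ l3 ^ 2)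
    (hinner : ∀ w, ∀ X : E3 →ₗ[ℝ] E3, FarWindowData (1 / 25) (1 / 2000 - τ) w X → ‖gramChart X - x₀ w‖ < r₁ w →
      b * windowSixUp w X ^ 2 ≤ windowTwelveLo w X)
    (houter : ∀ w, ∀ X : E3 →ₗ[ℝ] E3, FarWindowData (1 / 25) (1 / 2000 - τ) w X → ρ₁ w < ‖gramChart X - x₀ w‖ →
      b * windowSixUp w X ^ 2 ≤ windowTwelveLo w X)
    (hupper : ∀ w, ∀ X : E3 →ₗ[ℝ] E3, FarWindowData (1 / 25) (1 / 2000 - τ) w X → r₁ w ≤ ‖gramChart X - x₀ w‖ →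
      ‖gramChart X - x₀ w‖ ≤ ρ₁ w → chartScale X ^ 6 * windowSixUp w X ≤ PJ (D w) (J₃ w) (gramChart X))
    (hlower : ∀ w, ∀ X : E3 →ₗ[ℝ] E3, FarWindowData (1 / 25) (1 / 2000 - τ) w X → r₁ w ≤ ‖gramChart X - x₀ w‖ →
      ‖gramChart X - x₀ w‖ ≤ ρ₁ w → NJ (D w) (J₆ w) (gramChart X) ≤ chartScale X ^ 12 * windowTwelveLo w X)
    (hx₀ : ∀ w, x₀ w ∈ KRegion (196 / 121)) (hρ₁ : ∀ w, 0 ≤ ρ₁ w)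
    (hpos : ∀ w, ∀ y ∈ KRegion (196 / 121) ∩ Metric.closedBall (x₀ w) (ρ₁ w), ∀ i ∈ (D w).s, (D w).c i + (D w).L i y ≠ 0)
    (hP : ∀ w, ∀ y ∈ KRegion (196 / 121) ∩ Metric.closedBall (x₀ w) (ρ₁ w), 0 < PJ (D w) (J₃ w) y)
    (hC : ∀ w, ∀ y ∈ KRegion (196 / 121) ∩ Metric.closedBall (x₀ w) (ρ₁ w), ‖y - x₀ w‖ ≤ ρ w → ∀ u : E5, ‖u‖ = 1 →
      m₀ w ≤ psiJ₂ (D w) (J₃ w) (J₆ w) y u)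
    (hB : ∀ w, ∀ y ∈ KRegion (196 / 121) ∩ Metric.closedBall (x₀ w) (ρ₁ w), ρ w ≤ ‖y - x₀ w‖ →
      0 < psiJ₁ (D w) (J₃ w) (J₆ w) y (‖y - x₀ w‖⁻¹ • (y - x₀ w)) ∨
        0 < psiJ₂ (D w) (J₃ w) (J₆ w) y (‖y - x₀ w‖⁻¹ • (y - x₀ w)))
    (hG : ∀ w, ∀ u : E5, ‖u‖ = 1 → -η w ≤ psiJ₁ (D w) (J₃ w) (J₆ w) (x₀ w) u)
    (h0 : ∀ w, b - δ₀ w ≤ psiJ (D w) (J₃ w) (J₆ w) (x₀ w))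
    (hr₁ : ∀ w, 0 < r₁ w) (hrρ : ∀ w, r₁ w ≤ ρ w)
    (hq : ∀ w, ∀ t ∈ Icc (r₁ w) (ρ w), δ₀ w + η w * t ≤ m₀ w / 2 * t ^ 2) (hρη : ∀ w, η w < m₀ w * ρ w)
    (hb : 0 ≤ b) (hbD : L6hi ≤ b * (l3 ^ 2 - 24 * (1 / (2 * 10 ^ 7) + 1 / 10 ^ 9) * L6hi)) :
    FarCoreExcess (1 / 25) (1 / 2000) (1 / (2 * 10 ^ 7)) :=
  farCoreExcess_of_ratioTables hc hτ hτ' hl3 hL3 hL6 hκ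
    (fun w => table_of_split₃ (hinner w)
      (annulusTable_of_radialTablesJ (hupper w) (hlower w) (hx₀ w) (hρ₁ w) (hpos w) (hP w) (hC w) (hB w) (hG w) (h0 w)
        (hr₁ w) (hrρ w) (hq w) (hρη w) hb) (houter w)) hbD

end EndToEndThree

end Summit.AtomisticToContinuum.Crystallization.Theorems.OverbindingBudgetAffineRadialJet

end
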